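import Mathlib
import Summits.Ventures.HodgeRepro.Tier4.Line4.NaturalWitnessMu

/-!
# Tier4/Line4/LevelDCFinFactor — the plain level double-coset indicator `levelDC N` is a compactly supported finite
factor (`IsFinFactor`), and `e ⊗ levelDC N` is a test function on `G(𝔸)`

Blind re-derivation cell `pub-hodge-repro`, Tier 4 «prove the step» (README §9–§10), seat t4-L4-p1 (prover, LINE L4,
gen 5; the one unowned small lemma of L4-x2 g0's S15902 note, taken S15907).  Tree path
`lean/Summits/Ventures/HodgeRepro/Tier4/Line4/LevelDCFinFactor.lean`.  Mathlib-level; no literature.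

WHAT IS PROVED.  `levelDC W γ₀ N x = 1[x_f ∈ K(N) γ₀,f K(N)]` (L2-p1's LevelIndicator) is, for `N ≠ 0`,
* `isFinFactor_levelDC` — an `L1Class.IsFinFactor`: continuous (`continuous_levelDC`), a function of the finite coordinate
  (`levelDC_ofFinPart`), with compact support in `G(𝔸_f)` (the support lies in the double coset `K(N) γ₀,f K(N)`, compact
  by L1-p1's `isCompact_levelDoubleCosetSet`);
* `isTestFn_prodFn_levelDC` — `e ⊗ levelDC N` is a test function on `G(𝔸)` for every archimedean factor `e`
  (`IsInfFactor`), through L1-p1's `isTestFn_prodFn`;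
* `isFinFactor_levelDC_lev` — the same along a level sequence `lev` with `lev n ≠ 0`.
This is the `IsFinFactor (levelDC …)` clause that the `ChainInputs` witness instance (`chainInputs_of_pieces` at
`Ffin := levelDC γ₀ (lev N)`) and the Poincaré bridge consume; it is the `levelDC` twin of `isFinFactor_ffinMu`
(NaturalWitnessMu) and of `isFinFactor_levelInd` (ProductWitness).

Nothing here says anything about the status of the Hodge conjecture for CM abelian varieties, which is NOT proved
(HC_CM is NOT proved by anyone in this repository).
-/

set_option autoImplicit false

noncomputable section

namespace Summit.Ventures.HodgeRepro.Tier4.Line4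

open Summit.Ventures.HodgeRepro.Tier4 Summit.Ventures.HodgeRepro.Tier4.Common Summit.Ventures.HodgeRepro.Tier4.Line1
  Summit.Ventures.HodgeRepro.Tier4.Line4.L1Class

section LevelDCFinFactor

variable {k : Type} [Field k] [NumberField k] (W : PlaneData k) (γ₀ : GA W)

/-- **`levelDC N` is a compactly supported finite factor** for `N ≠ 0`: continuous, a function of the finite coordinate,
support inside the compact double coset `K(N) γ₀,f K(N) ⊆ G(𝔸_f)`. -/
theorem isFinFactor_levelDC {N : ℕ} (hN : N ≠ 0) : IsFinFactor W (levelDC W γ₀ N) := by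
  refine ⟨continuous_levelDC W γ₀ N hN, fun x => (levelDC_ofFinPart W γ₀ N x).symm, ?_⟩
  refine HasCompactSupport.intro (isCompact_levelDoubleCosetSet W γ₀ hN) fun y hy => ?_
  by_contra hne
  exact hy (mem_levelDoubleCoset_of_levelDC_ne_zero W γ₀ N y.2 hne)

/-- **`e ⊗ levelDC N` is a test function on `G(𝔸)`** for an archimedean factor `e` and `N ≠ 0`. -/
theorem isTestFn_prodFn_levelDC {e : GA W → ℂ} (he : IsInfFactor W e) {N : ℕ} (hN : N ≠ 0) :
    IsTestFn W (prodFn W e (levelDC W γ₀ N)) :=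
  isTestFn_prodFn W he (isFinFactor_levelDC W γ₀ hN)

/-- `levelDC (lev n)` is a compactly supported finite factor along a level sequence with `lev n ≠ 0`. -/
theorem isFinFactor_levelDC_lev (lev : ℕ → ℕ) (hlev : ∀ n, lev n ≠ 0) (n : ℕ) :
    IsFinFactor W (levelDC W γ₀ (lev n)) :=
  isFinFactor_levelDC W γ₀ (hlev n)

end LevelDCFinFactor

end Summit.Ventures.HodgeRepro.Tier4.Line4
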